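import Mathlib
import Literature.Analysis.FluidPDE.KNSSTypeIRateMildProofs
import Literature.Analysis.FluidPDE.NSLerayHopfSereginStability
import Literature.Analysis.FluidPDE.BoundedWeakIsometry
import Summits.NavierStokesRegularity.NavierStokesRegularity.Theorems.TypeILiouvilleLatticeLiouville
import Summits.NavierStokesRegularity.NavierStokesRegularity.Theorems.TypeILiouvilleShorelineContinuation

/-!
# TypeILiouvilleLatticeScaled — crux (L) stmt-NavierStokesRegularity-10661 `TypeIliouvilleL`:
# the periodic sieve for EVERY CUBIC LATTICE (any period `L > 0`, any orientation)

Helper for stmt-NavierStokesRegularity-10661 (`--supports`); theorems only, no definitions, no named-fact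
hypotheses; closes no item; Navier–Stokes regularity is NOT proved here (leafhand seat of the
EulerZoomLiouville route, LAND-ONLY).

The periodic sieve `TypeILiouvilleLatticeMomentum.classP_const_of_isLatticePeriodic` is stated for the unit
lattice `ℤ³`.  Print's class P is invariant under the parabolic zoom `v ↦ c v(c²·, c·)` and under conjugation by
linear isometries, so the sieve holds for every cubic lattice `L·R(ℤ³)`:

* `classP_zoom` — the Navier–Stokes zoom `w(s,y) = c v(c²s, cy)` (`c > 0`) maps print's class P to itself
  (Oseen covariance `heatExtension_smul_stPull` / `oseenDuhamel_smul_stPull` of the tree; KNSS 2009 §4).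
* `classP_const_of_isLatticePeriodic_scaled` — a class-P member periodic under `L ℤ³` (`L > 0`) is one
  constant vector.
* `classP_const_of_isLatticePeriodic_cubic` — the same for the rotated lattices `L·R(ℤ³)`, `R` a linear
  isometry (`TypeILiouvilleShoreline.classP_conj_linearIsometryEquiv`, `IsWeaklyDivFree.conj_linearIsometryEquiv`).

[cite: KochNadirashviliSereginSverak2009, §4 p. 8 (arXiv:0709.3599)]
-/

noncomputable section
open MeasureTheory Filter Set Function Metric
open scoped Topology
open Literature.Analysis Literature.Analysis.FunctionSpaces Literature.Analysis.FluidPDE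
  Literature.Analysis.UnboundedOperators
set_option linter.dupNamespace false
namespace Summit.NavierStokesRegularity.NavierStokesRegularity.Theorems.TypeILiouvilleLatticeMomentum

/-- **Print's class P is invariant under the Navier–Stokes zoom** `w(s,y) = c·v(c²s, cy)`, `c > 0`, about the
space–time origin: continuity and boundedness on `(−∞,0) × ℝ³`, weak divergence-freeness of the slices and the
Oseen integral equation are all transported (the last by the tree's Oseen covariance lemmas
`heatExtension_smul_stPull`, `oseenDuhamel_smul_stPull`). [cite: KochNadirashviliSereginSverak2009, §4 (i) p. 8 (arXiv:0709.3599)] -/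
theorem classP_zoom
    {v : ℝ → EuclideanSpace ℝ (Fin 3) → EuclideanSpace ℝ (Fin 3)}
    (hc : ContinuousOn (uncurry v) (Iio 0 ×ˢ univ))
    (hK : ∃ K : ℝ, ∀ t < 0, ∀ x, ‖v t x‖ ≤ K)
    (hd : ∀ t < 0, IsWeaklyDivFree (v t))
    (hm : ∀ s t : ℝ, s < t → t < 0 → ∀ x,
      v t x = heatExtension (v s) (t - s) x - oseenDuhamel 1 s v v t x)
    {c : ℝ} (hcpos : 0 < c) :
    ContinuousOn (uncurry fun (s : ℝ) (y : EuclideanSpace ℝ (Fin 3)) => c • v (c ^ 2 * s) (c • y))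
        (Iio 0 ×ˢ univ) ∧
      (∃ K : ℝ, ∀ t < 0, ∀ x, ‖(fun (s : ℝ) (y : EuclideanSpace ℝ (Fin 3)) => c • v (c ^ 2 * s) (c • y)) t x‖
        ≤ K) ∧
      (∀ t < 0, IsWeaklyDivFree ((fun (s : ℝ) (y : EuclideanSpace ℝ (Fin 3)) => c • v (c ^ 2 * s) (c • y)) t)) ∧
      (∀ s t : ℝ, s < t → t < 0 → ∀ x,
        (fun (s : ℝ) (y : EuclideanSpace ℝ (Fin 3)) => c • v (c ^ 2 * s) (c • y)) t x =
          heatExtension ((fun (s : ℝ) (y : EuclideanSpace ℝ (Fin 3)) => c • v (c ^ 2 * s) (c • y)) s)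
              (t - s) x -
            oseenDuhamel 1 s (fun (s : ℝ) (y : EuclideanSpace ℝ (Fin 3)) => c • v (c ^ 2 * s) (c • y))
              (fun (s : ℝ) (y : EuclideanSpace ℝ (Fin 3)) => c • v (c ^ 2 * s) (c • y)) t x) := by
  have hc2 : 0 < c ^ 2 := by positivity
  -- the zoomed field is the tree's `c • stPull (c²) c 0 0 v`
  have hw : (fun (s : ℝ) (y : EuclideanSpace ℝ (Fin 3)) => c • v (c ^ 2 * s) (c • y)) =
      c • stPull (c ^ 2) c 0 (0 : EuclideanSpace ℝ (Fin 3)) v := by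
    funext s y
    simp [stPull_apply]
  refine ⟨?_, ?_, ?_, ?_⟩
  · have hmap : ContinuousOn (fun q : ℝ × EuclideanSpace ℝ (Fin 3) => (c ^ 2 * q.1, c • q.2))
        (Iio 0 ×ˢ univ) := by fun_prop
    have hmaps : MapsTo (fun q : ℝ × EuclideanSpace ℝ (Fin 3) => (c ^ 2 * q.1, c • q.2))
        (Iio 0 ×ˢ univ) (Iio 0 ×ˢ univ) := by
      intro q hq
      refine ⟨?_, mem_univ _⟩
      have h1 : q.1 < 0 := (mem_prod.1 hq).1
      show c ^ 2 * q.1 < 0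
      nlinarith
    exact ((hc.comp hmap hmaps).const_smul c).congr fun q _ => rfl
  · obtain ⟨K, hKb⟩ := hK
    refine ⟨c * K, fun t ht x => ?_⟩
    have ht' : c ^ 2 * t < 0 := by nlinarith
    calc ‖c • v (c ^ 2 * t) (c • x)‖ = c * ‖v (c ^ 2 * t) (c • x)‖ := by
          rw [norm_smul, Real.norm_of_nonneg hcpos.le]
      _ ≤ c * K := mul_le_mul_of_nonneg_left (hKb _ ht' _) hcpos.le
  · intro t ht
    have ht' : c ^ 2 * t < 0 := by nlinarith
    exact (hd _ ht').dilate hcpos c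
  · intro s t hst ht y
    have hs' : c ^ 2 * s < c ^ 2 * t := by nlinarith
    have ht' : c ^ 2 * t < 0 := by nlinarith
    rw [hw]
    have hH := heatExtension_smul_stPull hcpos 0 (0 : EuclideanSpace ℝ (Fin 3)) v s
      (T := t - s) (sub_pos.2 hst) y
    have hD := oseenDuhamel_smul_stPull hcpos 0 (0 : EuclideanSpace ℝ (Fin 3)) v hst.le y
    rw [hH, hD]
    simp only [zero_add]
    have h1 := hm (c ^ 2 * s) (c ^ 2 * t) hs' ht' (c • y)
    rw [show c ^ 2 * t - c ^ 2 * s = c ^ 2 * (t - s) by ring] at h1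
    show (c • stPull (c ^ 2) c 0 (0 : EuclideanSpace ℝ (Fin 3)) v) t y = _
    simp only [Pi.smul_apply, stPull_apply, zero_add]
    rw [h1, smul_sub]

/-- **The periodic sieve at any period.**  A member of print's class P whose slices are periodic under the
scaled lattice `L ℤ³` (`v(t, x + L e_j) = v(t, x)`, `L > 0`) is one constant vector: zoom by `c = L` to a
`ℤ³`-periodic member (`classP_zoom`) and apply `classP_const_of_isLatticePeriodic`. [cite: KochNadirashviliSereginSverak2009, §4 p. 8 (arXiv:0709.3599)] -/
theorem classP_const_of_isLatticePeriodic_scaled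
    {v : ℝ → EuclideanSpace ℝ (Fin 3) → EuclideanSpace ℝ (Fin 3)}
    (hc : ContinuousOn (uncurry v) (Iio 0 ×ˢ univ))
    (hK : ∃ K : ℝ, ∀ t < 0, ∀ x, ‖v t x‖ ≤ K)
    (hd : ∀ t < 0, IsWeaklyDivFree (v t))
    (hm : ∀ s t : ℝ, s < t → t < 0 → ∀ x,
      v t x = heatExtension (v s) (t - s) x - oseenDuhamel 1 s v v t x)
    {L : ℝ} (hL : 0 < L)
    (hper : ∀ t < 0, ∀ (j : Fin 3) (x : EuclideanSpace ℝ (Fin 3)),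
      v t (x + L • EuclideanSpace.single j 1) = v t x) :
    ∃ b : EuclideanSpace ℝ (Fin 3), ∀ t < 0, ∀ x, v t x = b := by
  obtain ⟨hwc, hwK, hwd, hwm⟩ := classP_zoom hc hK hd hm hL
  have hwper : ∀ t < 0, Torus.IsLatticePeriodic
      ((fun (s : ℝ) (y : EuclideanSpace ℝ (Fin 3)) => L • v (L ^ 2 * s) (L • y)) t) := by
    intro t ht j y
    have hL2 : 0 < L ^ 2 := by positivity
    have ht' : L ^ 2 * t < 0 := mul_neg_of_pos_of_neg hL2 ht
    show L • v (L ^ 2 * t) (L • (y + EuclideanSpace.single j 1)) = L • v (L ^ 2 * t) (L • y)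
    rw [smul_add, hper _ ht' j]
  obtain ⟨b, hb⟩ := classP_const_of_isLatticePeriodic hwc hwK hwd hwm hwper
  refine ⟨L⁻¹ • b, fun t ht x => ?_⟩
  have hL0 : L ≠ 0 := hL.ne'
  have hL2 : 0 < L ^ 2 := by positivity
  have ht' : (L ^ 2)⁻¹ * t < 0 := mul_neg_of_pos_of_neg (inv_pos.2 hL2) ht
  have h1 : L • v (L ^ 2 * ((L ^ 2)⁻¹ * t)) (L • L⁻¹ • x) = b := hb _ ht' _
  rw [← mul_assoc, mul_inv_cancel₀ (pow_ne_zero 2 hL0), one_mul, smul_smul, mul_inv_cancel₀ hL0,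
    one_smul] at h1
  rw [← h1, smul_smul, inv_mul_cancel₀ hL0, one_smul]

/-- **The periodic sieve for every cubic lattice** `L·R(ℤ³)` (`L > 0`, `R` a linear isometry of `ℝ³`): a member
of print's class P with `v(t, x + L·R e_j) = v(t, x)` for `j = 0,1,2` is one constant vector (conjugate by
`R` — `TypeILiouvilleShoreline.classP_conj_linearIsometryEquiv`, `IsWeaklyDivFree.conj_linearIsometryEquiv` —
and apply `classP_const_of_isLatticePeriodic_scaled`). [cite: KochNadirashviliSereginSverak2009, §4 p. 8 (arXiv:0709.3599)] -/
theorem classP_const_of_isLatticePeriodic_cubic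
    {v : ℝ → EuclideanSpace ℝ (Fin 3) → EuclideanSpace ℝ (Fin 3)}
    (hc : ContinuousOn (uncurry v) (Iio 0 ×ˢ univ))
    (hK : ∃ K : ℝ, ∀ t < 0, ∀ x, ‖v t x‖ ≤ K)
    (hd : ∀ t < 0, IsWeaklyDivFree (v t))
    (hm : ∀ s t : ℝ, s < t → t < 0 → ∀ x,
      v t x = heatExtension (v s) (t - s) x - oseenDuhamel 1 s v v t x)
    (R : EuclideanSpace ℝ (Fin 3) ≃ₗᵢ[ℝ] EuclideanSpace ℝ (Fin 3)) {L : ℝ} (hL : 0 < L)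
    (hper : ∀ t < 0, ∀ (j : Fin 3) (x : EuclideanSpace ℝ (Fin 3)),
      v t (x + L • R (EuclideanSpace.single j 1)) = v t x) :
    ∃ b : EuclideanSpace ℝ (Fin 3), ∀ t < 0, ∀ x, v t x = b := by
  -- conjugate by `R.symm`: `u t x = R.symm (v t (R x))`
  obtain ⟨huc, huK, hum⟩ :=
    TypeILiouvilleShoreline.classP_conj_linearIsometryEquiv hc hK hm R.symm
  simp only [LinearIsometryEquiv.symm_symm] at huc huK hum
  have hud : ∀ t < 0, IsWeaklyDivFree (fun x => R.symm (v t (R x))) := by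
    intro t ht
    have h := (hd t ht).conj_linearIsometryEquiv R.symm
    simpa only [LinearIsometryEquiv.symm_symm] using h
  have huper : ∀ t < 0, ∀ (j : Fin 3) (x : EuclideanSpace ℝ (Fin 3)),
      (fun t x => R.symm (v t (R x))) t (x + L • EuclideanSpace.single j 1) =
        (fun t x => R.symm (v t (R x))) t x := by
    intro t ht j x
    show R.symm (v t (R (x + L • EuclideanSpace.single j 1))) = R.symm (v t (R x))
    rw [map_add, map_smul, hper t ht j]
  obtain ⟨b, hb⟩ := classP_const_of_isLatticePeriodic_scaled huc huK hud hum hL huper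
  refine ⟨R b, fun t ht x => ?_⟩
  have h1 := hb t ht (R.symm x)
  simp only [LinearIsometryEquiv.apply_symm_apply] at h1
  rw [← h1, LinearIsometryEquiv.apply_symm_apply]

end Summit.NavierStokesRegularity.NavierStokesRegularity.Theorems.TypeILiouvilleLatticeMomentum

end
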